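/-
Copyright (c) 2026. All rights reserved.
Released under Apache 2.0 license as described in the file LICENSE.
Authors: abc-iut cell, seat abc-iut-L6-t6 (proof-only tool over abc-iut-found's Definitions 1.1–1.2 API).
-/
import Mathlib.CategoryTheory.Equivalence
import Literature.AlgebraicGeometry.Frobenioids.PreFrobenioidEquivalence
import HarnessLib

/-!
# Frobenioids I, Definition 1.2 along an equivalence of categories

Mochizuki, *The geometry of Frobenioids I: the general theory*, Kyushu J. Math. **62** (2008),
§1, Definition 1.2 (kurims text pp. 21–24) [cite: MochizukiFrdI2008, Def. 1.2 p.21]. For an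
equivalence of categories `e : C' ≌ C` and a pre-Frobenioid structure `F : C → F_Φ`, the genuinely
categorical notions of Definition 1.2 for the induced structure `e.functor ⋙ F` on `C'` correspond to
those of `F` on the image: co-angular / LB-invertible / Frobenius-type arrows and co-angular pre-steps
(`…_equivalence_iff`, the ascending direction over a pre-Frobenioid, where isomorphisms are isometric
pre-steps), pull-back morphisms (both directions formally), isotropic and Frobenius-trivial objects,
isotropic hulls, and the units `O^×`. Proofs: map a factorisation / test object of `C'` into `C`, or
move one of `C` into the essential image along the counit isomorphisms and use
`PreFrobenioidEquivalence.lean`. Used by `FrobenioidEquivalence.lean` ("a category equivalent to a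
Frobenioid is a Frobenioid", as used in [FrdI] Thm. 5.2 (iv) and [IUTchI] Ex. 5.1 (iii)). No new
notion is defined; no statement of the paper is strengthened.
-/

namespace Literature.AlgebraicGeometry.Frobenioids

open CategoryTheory Opposite

universe w v v' v'' u u' u''

namespace PreFrobenioid

variable {D : Type u} [Category.{v} D] {Φ : Dᵒᵖ ⥤ CommMonCat.{w}}
  {C : Type u'} [Category.{v'} C] {C' : Type u''} [Category.{v''} C']
  {F : C ⥤ ElemFrobenioid Φ}

/-! ### Along an equivalence of categories `e : C' ≌ C` -/

section Equivalence

variable (e : C' ≌ C)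

/-- Co-angularity descends along an equivalence: if the image of `φ` is co-angular for `F` then `φ`
is co-angular for `e ⋙ F` (map a factorisation in `C'` into `C`). [cite: MochizukiFrdI2008, Def. 1.2(iii) p.22] -/
theorem IsCoAngular.of_equivalence {A B : C'} {φ : A ⟶ B} (h : IsCoAngular F (e.functor.map φ)) :
    IsCoAngular (e.functor ⋙ F) φ := by
  intro X Y γ β α hfac hα hβ₁ hβ₂ hbi
  haveI : IsIso (e.functor.map β) := by
    refine h (e.functor.map γ) (e.functor.map β) (e.functor.map α) ?_ hα hβ₁ hβ₂ hbi
    rw [← Functor.map_comp, ← Functor.map_comp, hfac]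
  exact isIso_of_reflects_iso β e.functor

/-- Co-angularity ascends along an equivalence of a pre-Frobenioid: if `φ` is co-angular for `e ⋙ F`
then its image is co-angular for `F` (transport a factorisation in `C` back to `C'` along the counit
isomorphisms; isomorphisms are isometric pre-steps, linear base-isomorphisms).
[cite: MochizukiFrdI2008, Def. 1.2(iii) p.22] -/
theorem IsCoAngular.map_of_equivalence (hP : IsPreFrobenioid Φ F) {A B : C'} {φ : A ⟶ B}
    (h : IsCoAngular (e.functor ⋙ F) φ) : IsCoAngular F (e.functor.map φ) := by
  intro X Y γ β α hfac hα hβ₁ hβ₂ hbi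
  let cX : e.functor.obj (e.inverse.obj X) ≅ X := e.counitIso.app X
  let cY : e.functor.obj (e.inverse.obj Y) ≅ Y := e.counitIso.app Y
  let γ' : A ⟶ e.inverse.obj X := e.functor.preimage (γ ≫ cX.inv)
  let β' : e.inverse.obj X ⟶ e.inverse.obj Y := e.functor.preimage (cX.hom ≫ β ≫ cY.inv)
  let α' : e.inverse.obj Y ⟶ B := e.functor.preimage (cY.hom ≫ α)
  have hγ' : e.functor.map γ' = γ ≫ cX.inv := e.functor.map_preimage _
  have hβ' : e.functor.map β' = cX.hom ≫ β ≫ cY.inv := e.functor.map_preimage _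
  have hα' : e.functor.map α' = cY.hom ≫ α := e.functor.map_preimage _
  have hfac' : γ' ≫ β' ≫ α' = φ := by
    apply e.functor.map_injective
    rw [Functor.map_comp, Functor.map_comp, hγ', hβ', hα', ← hfac]
    simp only [Category.assoc, Iso.inv_hom_id_assoc]
  haveI : IsIso β' := by
    refine h γ' β' α' hfac' ?_ ?_ ?_ ?_
    · show IsLinear F (e.functor.map α')
      rw [hα']
      exact IsLinear.comp F (isLinear_of_isIso F cY.hom) hα
    · show IsIsometry F (e.functor.map β')
      rw [hβ']
      exact IsIsometry.comp F (isIsometry_of_isIso F hP cX.hom)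
        (IsIsometry.comp F hβ₁ (isIsometry_of_isIso F hP cY.inv))
    · show IsPreStep F (e.functor.map β')
      rw [hβ']
      exact IsPreStep.comp F (isPreStep_of_isIso F cX.hom)
        (IsPreStep.comp F hβ₂ (isPreStep_of_isIso F cY.inv))
    · rcases hbi with hb | hb
      · left
        show IsBaseIso F (e.functor.map α')
        rw [hα']
        exact IsBaseIso.comp F (isBaseIso_of_isIso F cY.hom) hb
      · right
        show IsBaseIso F (e.functor.map γ')
        rw [hγ']
        exact IsBaseIso.comp F hb (isBaseIso_of_isIso F cX.inv)
  have hiso : IsIso (cX.hom ≫ β ≫ cY.inv) := by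
    rw [← hβ']
    infer_instance
  haveI : IsIso (β ≫ cY.inv) := IsIso.of_isIso_comp_left cX.hom (β ≫ cY.inv)
  exact IsIso.of_isIso_comp_right β cY.inv

/-- Co-angular for `e ⋙ F` iff the image is co-angular for `F` (pre-Frobenioid `F`).
[cite: MochizukiFrdI2008, Def. 1.2(iii) p.22] -/
theorem isCoAngular_equivalence_iff (hP : IsPreFrobenioid Φ F) {A B : C'} (φ : A ⟶ B) :
    IsCoAngular (e.functor ⋙ F) φ ↔ IsCoAngular F (e.functor.map φ) :=
  ⟨IsCoAngular.map_of_equivalence e hP, IsCoAngular.of_equivalence e⟩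

/-- LB-invertible for `e ⋙ F` iff the image is LB-invertible for `F`. [cite: MochizukiFrdI2008, Def. 1.2(iii) p.22] -/
theorem isLBInvertible_equivalence_iff (hP : IsPreFrobenioid Φ F) {A B : C'} (φ : A ⟶ B) :
    IsLBInvertible (e.functor ⋙ F) φ ↔ IsLBInvertible F (e.functor.map φ) :=
  and_congr (isCoAngular_equivalence_iff e hP φ) Iff.rfl

/-- Of Frobenius type for `e ⋙ F` from the image (no hypothesis needed in this direction).
[cite: MochizukiFrdI2008, Def. 1.2(iii) p.22] -/
theorem IsFrobeniusType.of_equivalence {A B : C'} {φ : A ⟶ B}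
    (h : IsFrobeniusType F (e.functor.map φ)) : IsFrobeniusType (e.functor ⋙ F) φ :=
  ⟨⟨IsCoAngular.of_equivalence e h.1.1, h.1.2⟩, h.2⟩

/-- Of Frobenius type for `e ⋙ F` iff the image is of Frobenius type for `F`.
[cite: MochizukiFrdI2008, Def. 1.2(iii) p.22] -/
theorem isFrobeniusType_equivalence_iff (hP : IsPreFrobenioid Φ F) {A B : C'} (φ : A ⟶ B) :
    IsFrobeniusType (e.functor ⋙ F) φ ↔ IsFrobeniusType F (e.functor.map φ) :=
  and_congr (isLBInvertible_equivalence_iff e hP φ) Iff.rfl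

/-- Co-angular pre-step for `e ⋙ F` iff the image is one for `F`. [cite: MochizukiFrdI2008, Def. 1.3(iii) p.25] -/
theorem isCoAngularPreStep_equivalence_iff (hP : IsPreFrobenioid Φ F) {A B : C'} (φ : A ⟶ B) :
    IsCoAngularPreStep (e.functor ⋙ F) φ ↔ IsCoAngularPreStep F (e.functor.map φ) :=
  and_congr (isCoAngular_equivalence_iff e hP φ) Iff.rfl

/-- Pull-back morphisms descend along an equivalence. [cite: MochizukiFrdI2008, Def. 1.2(ii) p.21] -/
theorem IsPullbackMorphism.of_equivalence {A B : C'} {φ : A ⟶ B}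
    (h : IsPullbackMorphism F (e.functor.map φ)) : IsPullbackMorphism (e.functor ⋙ F) φ := by
  intro X
  constructor
  · intro γ₁ γ₂ hγ
    have h1 : γ₁ ≫ φ = γ₂ ≫ φ :=
      congrArg (fun p : PullbackHomData (e.functor ⋙ F) φ X => p.1.1) hγ
    have h2 : Base (e.functor ⋙ F) γ₁ = Base (e.functor ⋙ F) γ₂ :=
      congrArg (fun p : PullbackHomData (e.functor ⋙ F) φ X => p.1.2) hγ
    apply e.functor.map_injective
    apply (h (e.functor.obj X)).1
    apply Subtype.ext
    apply Prod.ext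
    · show e.functor.map γ₁ ≫ e.functor.map φ = e.functor.map γ₂ ≫ e.functor.map φ
      rw [← Functor.map_comp, h1, Functor.map_comp]
    · exact h2
  · rintro ⟨⟨δ, ε⟩, hδ⟩
    dsimp only at hδ
    obtain ⟨γ, hγ⟩ := (h (e.functor.obj X)).2 ⟨(e.functor.map δ, ε), hδ⟩
    have hγ1 : γ ≫ e.functor.map φ = e.functor.map δ :=
      congrArg (fun p : PullbackHomData F (e.functor.map φ) (e.functor.obj X) => p.1.1) hγ
    have hγ2 : Base F γ = ε :=
      congrArg (fun p : PullbackHomData F (e.functor.map φ) (e.functor.obj X) => p.1.2) hγ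
    refine ⟨e.functor.preimage γ, Subtype.ext (Prod.ext ?_ ?_)⟩
    · show e.functor.preimage γ ≫ φ = δ
      apply e.functor.map_injective
      rw [Functor.map_comp, e.functor.map_preimage, hγ1]
    · show Base F (e.functor.map (e.functor.preimage γ)) = ε
      rw [e.functor.map_preimage, hγ2]

/-- Pull-back morphisms ascend along an equivalence: the image of a pull-back morphism of `e ⋙ F` is a
pull-back morphism of `F` (test objects of `C` are moved into the image by the counit).
[cite: MochizukiFrdI2008, Def. 1.2(ii) p.21] -/
theorem IsPullbackMorphism.map_of_equivalence {A B : C'} {φ : A ⟶ B}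
    (h : IsPullbackMorphism (e.functor ⋙ F) φ) : IsPullbackMorphism F (e.functor.map φ) := by
  intro X
  let cX : e.functor.obj (e.inverse.obj X) ≅ X := e.counitIso.app X
  constructor
  · intro γ₁ γ₂ hγ
    have h1 : γ₁ ≫ e.functor.map φ = γ₂ ≫ e.functor.map φ :=
      congrArg (fun p : PullbackHomData F (e.functor.map φ) X => p.1.1) hγ
    have h2 : Base F γ₁ = Base F γ₂ :=
      congrArg (fun p : PullbackHomData F (e.functor.map φ) X => p.1.2) hγ
    let δ₁ : e.inverse.obj X ⟶ A := e.functor.preimage (cX.hom ≫ γ₁)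
    let δ₂ : e.inverse.obj X ⟶ A := e.functor.preimage (cX.hom ≫ γ₂)
    have hδ₁ : e.functor.map δ₁ = cX.hom ≫ γ₁ := e.functor.map_preimage _
    have hδ₂ : e.functor.map δ₂ = cX.hom ≫ γ₂ := e.functor.map_preimage _
    have key : δ₁ = δ₂ := by
      apply (h (e.inverse.obj X)).1
      apply Subtype.ext
      apply Prod.ext
      · show δ₁ ≫ φ = δ₂ ≫ φ
        apply e.functor.map_injective
        rw [Functor.map_comp, Functor.map_comp, hδ₁, hδ₂, Category.assoc, Category.assoc, h1]
      · show Base F (e.functor.map δ₁) = Base F (e.functor.map δ₂)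
        rw [hδ₁, hδ₂, base_comp, base_comp, h2]
    have hc : cX.hom ≫ γ₁ = cX.hom ≫ γ₂ := by rw [← hδ₁, ← hδ₂, key]
    exact (cancel_epi cX.hom).mp hc
  · rintro ⟨⟨δ, ε⟩, hδ⟩
    dsimp only at hδ
    let δ' : e.inverse.obj X ⟶ B := e.functor.preimage (cX.hom ≫ δ)
    have hδ' : e.functor.map δ' = cX.hom ≫ δ := e.functor.map_preimage _
    obtain ⟨γ', hγ'⟩ := (h (e.inverse.obj X)).2
      ⟨(δ', Base F cX.hom ≫ ε), by
        show Base F (e.functor.map δ') = (Base F cX.hom ≫ ε) ≫ Base F (e.functor.map φ)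
        rw [hδ', base_comp, hδ, Category.assoc]⟩
    have hγ'1 : γ' ≫ φ = δ' :=
      congrArg (fun p : PullbackHomData (e.functor ⋙ F) φ (e.inverse.obj X) => p.1.1) hγ'
    have hγ'2 : Base F (e.functor.map γ') = Base F cX.hom ≫ ε :=
      congrArg (fun p : PullbackHomData (e.functor ⋙ F) φ (e.inverse.obj X) => p.1.2) hγ'
    refine ⟨cX.inv ≫ e.functor.map γ', Subtype.ext (Prod.ext ?_ ?_)⟩
    · show (cX.inv ≫ e.functor.map γ') ≫ e.functor.map φ = δ
      rw [Category.assoc, ← Functor.map_comp, hγ'1, hδ', Iso.inv_hom_id_assoc]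
    · show Base F (cX.inv ≫ e.functor.map γ') = ε
      rw [base_comp, hγ'2, ← Category.assoc, ← base_comp, Iso.inv_hom_id, base_id, Category.id_comp]

/-- Pull-back morphism for `e ⋙ F` iff the image is a pull-back morphism for `F`.
[cite: MochizukiFrdI2008, Def. 1.2(ii) p.21] -/
theorem isPullbackMorphism_equivalence_iff {A B : C'} (φ : A ⟶ B) :
    IsPullbackMorphism (e.functor ⋙ F) φ ↔ IsPullbackMorphism F (e.functor.map φ) :=
  ⟨IsPullbackMorphism.map_of_equivalence e, IsPullbackMorphism.of_equivalence e⟩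

/-- Isotropy descends along an equivalence. [cite: MochizukiFrdI2008, Def. 1.2(iv) p.24] -/
theorem IsIsotropic.of_equivalence {A : C'} (h : IsIsotropic F (e.functor.obj A)) :
    IsIsotropic (e.functor ⋙ F) A := by
  intro X ψ h1 h2
  haveI : IsIso (e.functor.map ψ) := h (e.functor.map ψ) h1 h2
  exact isIso_of_reflects_iso ψ e.functor

/-- Isotropy ascends along an equivalence of a pre-Frobenioid. [cite: MochizukiFrdI2008, Def. 1.2(iv) p.24] -/
theorem IsIsotropic.map_of_equivalence (hP : IsPreFrobenioid Φ F) {A : C'}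
    (h : IsIsotropic (e.functor ⋙ F) A) : IsIsotropic F (e.functor.obj A) := by
  intro X ψ h1 h2
  let cX : e.functor.obj (e.inverse.obj X) ≅ X := e.counitIso.app X
  let ψ' : A ⟶ e.inverse.obj X := e.functor.preimage (ψ ≫ cX.inv)
  have hψ' : e.functor.map ψ' = ψ ≫ cX.inv := e.functor.map_preimage _
  haveI : IsIso ψ' :=
    h ψ' (by
        show IsIsometry F (e.functor.map ψ')
        rw [hψ']
        exact IsIsometry.comp F h1 (isIsometry_of_isIso F hP cX.inv))
      (by
        show IsPreStep F (e.functor.map ψ')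
        rw [hψ']
        exact IsPreStep.comp F h2 (isPreStep_of_isIso F cX.inv))
  have hiso : IsIso (ψ ≫ cX.inv) := by
    rw [← hψ']
    infer_instance
  exact IsIso.of_isIso_comp_right ψ cX.inv

/-- Isotropic for `e ⋙ F` iff the image is isotropic for `F` (pre-Frobenioid `F`).
[cite: MochizukiFrdI2008, Def. 1.2(iv) p.24] -/
theorem isIsotropic_equivalence_iff (hP : IsPreFrobenioid Φ F) (A : C') :
    IsIsotropic (e.functor ⋙ F) A ↔ IsIsotropic F (e.functor.obj A) :=
  ⟨IsIsotropic.map_of_equivalence e hP, IsIsotropic.of_equivalence e⟩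

/-- Isotropic hulls descend along an equivalence of a pre-Frobenioid.
[cite: MochizukiFrdI2008, Def. 1.2(iv) p.24] -/
theorem IsIsotropicHull.of_equivalence (hP : IsPreFrobenioid Φ F) {A B : C'} {φ : A ⟶ B}
    (h : IsIsotropicHull F (e.functor.map φ)) : IsIsotropicHull (e.functor ⋙ F) φ := by
  obtain ⟨h1, h2, h3, h4⟩ := h
  refine ⟨h1, h2, IsIsotropic.of_equivalence e h3, ?_⟩
  intro X γ hX
  obtain ⟨β, hβ, huniq⟩ := h4 (e.functor.map γ) (IsIsotropic.map_of_equivalence e hP hX)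
  refine ⟨e.functor.preimage β, ?_, ?_⟩
  · show φ ≫ e.functor.preimage β = γ
    apply e.functor.map_injective
    rw [Functor.map_comp, e.functor.map_preimage]
    exact hβ
  · intro β' hβ'
    apply e.functor.map_injective
    rw [e.functor.map_preimage]
    exact huniq _ (by
      show e.functor.map φ ≫ e.functor.map β' = e.functor.map γ
      rw [← Functor.map_comp, hβ'])

/-- Frobenius-triviality descends along an equivalence: pull the section `ℕ_{≥1} → End(e A)` back
through the bijection `End(A) ≃ End(e A)`. [cite: MochizukiFrdI2008, Def. 1.2(iv) p.23] -/
theorem IsFrobeniusTrivial.of_equivalence {A : C'} (h : IsFrobeniusTrivial F (e.functor.obj A)) :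
    IsFrobeniusTrivial (e.functor ⋙ F) A := by
  obtain ⟨ζ, hζ⟩ := h
  let E : End A ≃* End (e.functor.obj A) :=
    MulEquiv.ofBijective (e.functor.mapEnd A)
      ⟨fun x y hxy => e.functor.map_injective hxy,
        fun x => ⟨e.functor.preimage x, e.functor.map_preimage x⟩⟩
  have hE : ∀ x, e.functor.map (E.symm x) = x := fun x => E.apply_symm_apply x
  refine ⟨E.symm.toMonoidHom.comp ζ, fun n => ⟨?_, ?_, ?_⟩⟩
  · show degFr F (e.functor.map (E.symm (ζ n))) = n
    rw [hE]
    exact (hζ n).1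
  · show Base F (e.functor.map (E.symm (ζ n))) = 𝟙 _
    rw [hE]
    exact (hζ n).2.1
  · show IsFrobeniusType (e.functor ⋙ F) (E.symm (ζ n))
    refine IsFrobeniusType.of_equivalence e ?_
    rw [hE]
    exact (hζ n).2.2

/-- Frobenius-triviality ascends along an equivalence of a pre-Frobenioid.
[cite: MochizukiFrdI2008, Def. 1.2(iv) p.23] -/
theorem IsFrobeniusTrivial.map_of_equivalence (hP : IsPreFrobenioid Φ F) {A : C'}
    (h : IsFrobeniusTrivial (e.functor ⋙ F) A) : IsFrobeniusTrivial F (e.functor.obj A) := by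
  obtain ⟨ζ, hζ⟩ := h
  refine ⟨(e.functor.mapEnd A).comp ζ, fun n => ⟨(hζ n).1, (hζ n).2.1, ?_⟩⟩
  exact (isFrobeniusType_equivalence_iff e hP _).mp (hζ n).2.2

/-- The units `O^×` of the image of an object come from units of the object: every
`α ∈ O^×(e B)` is `e(α')` for a unique `α' ∈ O^×(B)`. [cite: MochizukiFrdI2008, Def. 1.2(ii) p.22] -/
theorem exists_preimage_mem_unitsSubgroup {B : C'} (α : Aut (e.functor.obj B))
    (hα : α ∈ unitsSubgroup F (e.functor.obj B)) :
    ∃ α' : Aut B, α' ∈ unitsSubgroup (e.functor ⋙ F) B ∧ e.functor.mapIso α' = α := by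
  have hhom : e.functor.map (e.functor.preimageIso α).hom = α.hom := by
    rw [Functor.preimageIso_hom, Functor.map_preimage]
  refine ⟨e.functor.preimageIso α, ?_, Iso.ext hhom⟩
  obtain ⟨h1, h2⟩ := hα
  refine ⟨?_, ?_⟩
  · show Base F (e.functor.map (e.functor.preimageIso α).hom) = 𝟙 _
    rw [hhom]
    exact h1
  · show degFr F (e.functor.map (e.functor.preimageIso α).hom) = 1
    rw [hhom]
    exact h2

/-! ### `O^▷` along an equivalence (for Definition 1.3 (iii)(c)) -/

/-- The fully faithful `e.functor` identifies `O^▷(A) ⊆ End(A)` with `O^▷(e A) ⊆ End(e A)` as monoids.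
[cite: MochizukiFrdI2008, Def. 1.2(ii) p.22] -/
theorem exists_endSubmonoid_mulEquiv (A : C') :
    ∃ E : endSubmonoid (e.functor ⋙ F) A ≃* endSubmonoid F (e.functor.obj A),
      ∀ α, ((E α : endSubmonoid F (e.functor.obj A)) : End (e.functor.obj A)) =
        e.functor.map (α : End A) := by
  let f : endSubmonoid (e.functor ⋙ F) A →* endSubmonoid F (e.functor.obj A) :=
    { toFun := fun α => ⟨e.functor.map (α : End A), α.2⟩
      map_one' := Subtype.ext (e.functor.map_id A)
      map_mul' := fun x y => Subtype.ext (e.functor.map_comp (y : End A) (x : End A)) }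
  have hf : Function.Bijective f := by
    constructor
    · intro x y hxy
      exact Subtype.ext (e.functor.map_injective (congrArg Subtype.val hxy))
    · rintro ⟨g, hg⟩
      refine ⟨⟨e.functor.preimage g, ?_⟩, Subtype.ext (e.functor.map_preimage g)⟩
      obtain ⟨hg1, hg2⟩ := hg
      refine ⟨?_, ?_⟩
      · show Base F (e.functor.map (e.functor.preimage g)) = 𝟙 _
        rw [e.functor.map_preimage]
        exact hg1
      · show degFr F (e.functor.map (e.functor.preimage g)) = 1
        rw [e.functor.map_preimage]
        exact hg2
  exact ⟨MulEquiv.ofBijective f hf, fun α => rfl⟩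

end Equivalence

end PreFrobenioid

end Literature.AlgebraicGeometry.Frobenioids
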